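import Mathlib
import Literature.Analysis.FluidPDE.HardSphereCollisionRecord
import Literature.Analysis.FluidPDE.HardSphereTorusMeasure
import Literature.MathematicalPhysics.KineticTheory.HardSphereEuler
import Literature.MathematicalPhysics.KineticTheory.HardSphereEulerProofs
import Summits.AtomisticToContinuum.HydrodynamicLimit.Theorems.OneFlightGossipEngineOneFlightLayeredChaosFirstFlightGhostInput
import Summits.AtomisticToContinuum.HydrodynamicLimit.Theorems.OneFlightGossipEngineOneFlightLayeredChaosEntranceLawTorus
import Literature.Analysis.FluidPDE.HardSphereTranslation
import Summits.AtomisticToContinuum.HydrodynamicLimit.Theorems.OneFlightGossipEngineOneFlightLayeredChaosPosGibbsTranslation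
import Summits.AtomisticToContinuum.HydrodynamicLimit.Theorems.OneFlightGossipEngineOneFlightLayeredChaosFirstFlightGhostTransfer
import Summits.AtomisticToContinuum.HydrodynamicLimit.Theorems.OneFlightGossipEngineOneFlightLayeredChaosTwoDirectionInput
import Summits.AtomisticToContinuum.HydrodynamicLimit.Theorems.OneFlightGossipEngineOneFlightLayeredChaosEntranceTimeMeasurable
import Summits.AtomisticToContinuum.HydrodynamicLimit.Theorems.OneFlightGossipEngineOneFlightLayeredChaosGhostAvoidMeasurable
import Summits.AtomisticToContinuum.HydrodynamicLimit.Theorems.OneFlightGossipEngineOneFlightLayeredChaosContactInversion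
import Summits.AtomisticToContinuum.HydrodynamicLimit.Theorems.OneFlightGossipEngineOneFlightLayeredChaosUniformMarginalAE
import HarnessLib

/-!
# `OneFlightGossipEngine.OneFlightLayeredChaos` — the first rung in contact coordinates, I: the entrance-coordinates identity
(crux stmt-AtomisticToContinuum-14535, line `Sketch`, lead cycle c4; part 1 of the transfer
`OLC.TwoDirectionGhostInput θ₀ → OLC.FirstFlightGhostInput θ₀`, crux notes §G2; registered carrier stub `contactConfig_update_self`).

On a velocity fibre `v` (all velocities frozen, `g = v_i − v_j ≠ 0`, no wrap-around `0 < ε < 1/4`, `‖g‖ w ≤ 1/4`) the position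
of the tagged particle `i` is re-parametrised by the contact data `(t, ω)` of its free flight against the partner's
(`OLC.contactConfig`, `…TwoDirectionInput` p142013). Main result `volume_inter_freeEntranceTime_mem_Ioc_eq` — THE
ENTRANCE-COORDINATES IDENTITY: for every measurable set `A` of position configurations,
`vol (A ∩ {t⋆ ∈ (0, w]}) = ∫_{S²} ∫_{(0,w]} vol (contactConfig_{t,ω}⁻¹ A) · ε² (−⟪ω, g⟫)₊ dt dσ(ω)`:
split off `x_i` by Fubini (`MeasurableEquiv.piFinSuccAbove`), translate by `x_j` (Haar invariance), apply the torus entrance law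
`lintegral_entranceLaw_torus` (p139760) fibrewise with `H = 𝟙_A ∘ contactConfig`, invert the parametrisation with
`proj ∘ reprSym = id`, and swap the integrals back (Tonelli). The measurability of the entrance time enters as a hypothesis
(discharged by `measurable_freeEntranceTime`, p142193, in part II).
-/

open scoped BigOperators ENNReal Topology
open MeasureTheory Set Filter
open Literature.Analysis.FluidPDE Literature.MathematicalPhysics.KineticTheory
open Literature.Analysis.FunctionSpaces

namespace Summit.AtomisticToContinuum.HydrodynamicLimit.Theorems.OLC

noncomputable section

/-! ## Elementary facts on contact coordinates -/

section ContactFacts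

variable {n : ℕ}

/-- The contact configuration does not depend on the position of `i` (registered carrier lemma of this file). [folklore] -/
theorem contactConfig_update_self : ∀ {n : ℕ} (ε : ℝ) (x : Fin n → Literature.MathematicalPhysics.KineticTheory.T3) (v : Fin n → Literature.MathematicalPhysics.KineticTheory.V3) {i j : Fin n}, j ≠ i → ∀ (t : ℝ) (ω : Literature.MathematicalPhysics.KineticTheory.V3) (p : Literature.MathematicalPhysics.KineticTheory.T3), Summit.AtomisticToContinuum.HydrodynamicLimit.Theorems.OLC.contactConfig ε (Function.update x i p) v i j t ω = Summit.AtomisticToContinuum.HydrodynamicLimit.Theorems.OLC.contactConfig ε x v i j t ω := by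
  intro n ε x v i j hij t ω p
  rw [contactConfig, contactConfig, contactPos_update_self ε x v hij, Function.update_idem]

/-- Measurability of the contact configuration, jointly in the configuration, the contact time and the direction.
[folklore] -/
theorem measurable_contactConfig (ε : ℝ) (v : Fin n → V3) (i j : Fin n) :
    Measurable fun p : (Fin n → T3) × ℝ × V3 => contactConfig ε p.1 v i j p.2.1 p.2.2 := by
  classical
  have h1 : Measurable fun p : (Fin n → T3) × ℝ × V3 => (p.1, contactPos ε p.1 v i j p.2.1 p.2.2) := by
    refine measurable_fst.prodMk ?_
    unfold contactPos
    refine ((measurable_pi_apply j).comp measurable_fst).add (Torus.measurable_proj.comp ?_)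
    exact ((measurable_snd.snd.const_smul ε).sub (measurable_snd.fst.smul_const (v i - v j)))
  have h2 : Measurable fun q : (Fin n → T3) × T3 => Function.update q.1 i q.2 := measurable_update'
  have : (fun p : (Fin n → T3) × ℝ × V3 => contactConfig ε p.1 v i j p.2.1 p.2.2) =
      (fun q : (Fin n → T3) × T3 => Function.update q.1 i q.2) ∘
        fun p : (Fin n → T3) × ℝ × V3 => (p.1, contactPos ε p.1 v i j p.2.1 p.2.2) := by
    funext p
    simp only [Function.comp_apply, contactConfig]
  rw [this]
  exact h2.comp h1

/-- The separation of the two free flights at time `t` is `reprSym ((x_i − x_j) + proj (t (v_i − v_j)))`. [folklore] -/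
theorem sepVec_freeFlight_eq (z : Config n (Fin 3) T3) (i j : Fin n) (t : ℝ) :
    (Torus.geometry (Fin 3)).sepVec (freeFlight (Torus.geometry (Fin 3)) t z i).1
        (freeFlight (Torus.geometry (Fin 3)) t z j).1 =
      Torus.reprSym (((z i).1 - (z j).1) + Torus.proj (t • ((z i).2 - (z j).2))) := by
  simp only [freeFlight_apply, Torus.geometry_sepVec, Torus.geometry_translate]
  congr 1
  rw [smul_sub, sub_eq_add_neg (t • (z i).2), Torus.proj_add, Torus.proj_neg]
  abel

end ContactFacts

/-! ## The entrance-coordinates identity -/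

section EntranceCoordinates

variable {N : ℕ}

/-- **The entrance-coordinates identity** (crux notes §G2, Step 1). On a velocity fibre `v` with `g = v_i − v_j ≠ 0`,
no wrap-around (`0 < ε < 1/4`, `‖g‖ w ≤ 1/4`): for every measurable set `A` of position configurations, the volume of
`A ∩ {entrance time ∈ (0, w]}` is the integral over the contact data `(ω, t) ∈ S² × (0, w]` of the entrance-law weight
`ε² (−⟪ω, g⟫)₊` times the volume of the pre-image of `A` under the contact parametrisation `x ↦ contactConfig ε x v i j t ω`
(split off `x_i` by Fubini, translate by `x_j`, apply the torus entrance law `lintegral_entranceLaw_torus` fibrewise with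
`H = 𝟙_A ∘ contactConfig`, invert the parametrisation with `proj ∘ reprSym = id`, and swap the integrals back). The
measurability of the entrance time is taken as a hypothesis (brick `measurable_freeEntranceTime`). [folklore] -/
theorem volume_inter_freeEntranceTime_mem_Ioc_eq {ε w : ℝ} (hε : 0 < ε) (hε4 : ε < 4⁻¹) (hw : 0 < w)
    (v : Fin (N + 1) → V3) {i j : Fin (N + 1)} (hij : j ≠ i) (hg : v i - v j ≠ 0) (hgw : ‖v i - v j‖ * w ≤ 4⁻¹)
    (hmeas : Measurable fun x : Fin (N + 1) → T3 => freeEntranceTime ε (zipConfig (x, v)) i j)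
    {A : Set (Fin (N + 1) → T3)} (hA : MeasurableSet A) :
    volume (A ∩ {x | freeEntranceTime ε (zipConfig (x, v)) i j ∈ Set.Ioc 0 w}) =
      ∫⁻ ω : Metric.sphere (0 : V3) 1, (∫⁻ t in Set.Ioc 0 w,
        volume ((fun x => contactConfig ε x v i j t (ω : V3)) ⁻¹' A) *
          ENNReal.ofReal (ε ^ 2 * max (-inner ℝ (ω : V3) (v i - v j)) 0)) ∂sphereMeasure := by
  classical
  set g : V3 := v i - v j with hgdef
  -- split off the coordinate `i`
  set e : (Fin (N + 1) → T3) ≃ᵐ T3 × (Fin N → T3) := MeasurableEquiv.piFinSuccAbove (fun _ => T3) i with hedef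
  have he : MeasurePreserving e volume (volume.prod volume) := volume_preserving_piFinSuccAbove (fun _ => T3) i
  -- insertion of a position at `i`
  obtain ⟨ins, hinsdef⟩ : ∃ ins : T3 → (Fin N → T3) → (Fin (N + 1) → T3),
      ins = fun p y => i.insertNth (α := fun _ => T3) p y := ⟨_, rfl⟩
  have hesymm : ∀ (p : T3) (y : Fin N → T3), e.symm (p, y) = ins p y := fun p y => by
    rw [hinsdef, hedef, MeasurableEquiv.piFinSuccAbove_symm_apply]
    rfl
  have hins_meas2 : Measurable fun q : T3 × (Fin N → T3) => ins q.1 q.2 := by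
    have h : (fun q : T3 × (Fin N → T3) => ins q.1 q.2) = e.symm := by
      funext q
      rw [← hesymm]
    rw [h]
    exact e.symm.measurable
  have hins_i : ∀ (p : T3) (y : Fin N → T3), ins p y i = p := fun p y => by
    rw [hinsdef]
    exact Fin.insertNth_apply_same (α := fun _ => T3) i p y
  obtain ⟨j', hj'⟩ := Fin.exists_succAbove_eq hij
  have hins_j : ∀ (p : T3) (y : Fin N → T3), ins p y j = y j' := fun p y => by
    rw [hinsdef]
    simp only
    rw [← hj', Fin.insertNth_apply_succAbove]
  have hins_update : ∀ (p p' : T3) (y : Fin N → T3), Function.update (ins p y) i p' = ins p' y := fun p p' y => by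
    rw [hinsdef]
    exact Fin.update_insertNth (α := fun _ => T3) i p p' y
  -- the configuration of the others, with a dummy value at `i`, and the position of `j`
  obtain ⟨X, hXdef⟩ : ∃ X : (Fin N → T3) → (Fin (N + 1) → T3), X = fun y => ins 0 y := ⟨_, rfl⟩
  obtain ⟨c, hcdef⟩ : ∃ c : (Fin N → T3) → T3, c = fun y => y j' := ⟨_, rfl⟩
  have hXj : ∀ y, X y j = c y := fun y => by
    rw [hXdef, hcdef]
    exact hins_j 0 y
  have hXmeas : Measurable X := by
    rw [hXdef]
    exact hins_meas2.comp (measurable_const.prodMk measurable_id)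
  have hins_eq_update : ∀ (p : T3) (y : Fin N → T3), ins p y = Function.update (X y) i p := by
    intro p y
    rw [hXdef, hins_update]
  -- the contact configuration seen through the splitting
  have hcC_ins : ∀ (p : T3) (y : Fin N → T3) (t : ℝ) (ω : V3),
      contactConfig ε (ins p y) v i j t ω = contactConfig ε (X y) v i j t ω := by
    intro p y t ω
    rw [hins_eq_update, contactConfig_update_self ε (X y) v hij]
  -- Step 1: Fubini over the splitting
  set S : Set (Fin (N + 1) → T3) := A ∩ {x | freeEntranceTime ε (zipConfig (x, v)) i j ∈ Set.Ioc 0 w} with hSdef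
  have hSm : MeasurableSet S := hA.inter (hmeas measurableSet_Ioc)
  have hS_eq : volume S = ∫⁻ y : Fin N → T3, volume {p : T3 | ins p y ∈ S} := by
    have h1 : volume S = (volume.prod volume) (e.symm ⁻¹' S) := by
      rw [← he.map_eq, MeasurableEquiv.map_apply]
      congr 1
      ext x
      simp
    rw [h1, Measure.prod_apply_symm (e.symm.measurable hSm)]
    refine lintegral_congr fun y => ?_
    congr 1
    ext p
    simp only [Set.mem_preimage, Set.mem_setOf_eq, hesymm]
  -- Step 2: the fibre over `y`, by translation and the torus entrance law
  -- the `H` of the entrance law: the indicator of the joint pre-image of `A`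
  have hm : Measurable ((fun p : (Fin (N + 1) → T3) × ℝ × V3 => contactConfig ε p.1 v i j p.2.1 p.2.2) ∘
      fun q : (Fin N → T3) × ℝ × V3 => (X q.1, q.2)) :=
    (measurable_contactConfig ε v i j).comp ((hXmeas.comp measurable_fst).prodMk measurable_snd)
  obtain ⟨Aj, hAjdef⟩ : ∃ Aj : Set ((Fin N → T3) × ℝ × V3),
      Aj = ((fun p : (Fin (N + 1) → T3) × ℝ × V3 => contactConfig ε p.1 v i j p.2.1 p.2.2) ∘
        fun q : (Fin N → T3) × ℝ × V3 => (X q.1, q.2)) ⁻¹' A := ⟨_, rfl⟩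
  have hAjm : MeasurableSet Aj := by
    rw [hAjdef]
    exact hA.preimage hm
  have hmemAj : ∀ (y : Fin N → T3) (t : ℝ) (ω : V3), (y, t, ω) ∈ Aj ↔ contactConfig ε (X y) v i j t ω ∈ A := by
    intro y t ω
    rw [hAjdef, Set.mem_preimage, Function.comp_apply]
  obtain ⟨H, hHdef⟩ : ∃ H : (Fin N → T3) → ℝ × V3 → ℝ≥0∞,
      H = fun y p => Aj.indicator (fun _ => (1 : ℝ≥0∞)) (y, p) := ⟨_, rfl⟩
  have hHjoint : Measurable fun q : (Fin N → T3) × ℝ × V3 => H q.1 q.2 := by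
    rw [hHdef]
    exact measurable_one.indicator hAjm
  have hHmeas : ∀ y, Measurable (H y) := fun y => hHjoint.comp (measurable_const.prodMk measurable_id)
  have hHapply : ∀ (y : Fin N → T3) (t : ℝ) (ω : V3),
      H y (t, ω) = if contactConfig ε (X y) v i j t ω ∈ A then 1 else 0 := by
    intro y t ω
    rw [hHdef]
    simp only [Set.indicator_apply, hmemAj]
  -- the entrance time of the free flights in the relative coordinate `q = x_i − x_j`
  have htE : ∀ (q : T3) (y : Fin N → T3),
      freeEntranceTime ε (zipConfig (ins (c y + q) y, v)) i j =
        sInf {t : ℝ | 0 < t ∧ ‖Torus.reprSym (q + Torus.proj (t • g))‖ ≤ ε} := by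
    intro q y
    unfold freeEntranceTime
    congr 1
    ext t
    simp only [Set.mem_setOf_eq, sepVec_freeFlight_eq, zipConfig_apply, hins_i, hins_j, hcdef]
    rw [add_sub_cancel_left]
  have hfib : ∀ y : Fin N → T3, volume {p : T3 | ins p y ∈ S} =
      ∫⁻ ω : Metric.sphere (0 : V3) 1, (∫⁻ t in Set.Ioc 0 w,
        H y (t, (ω : V3)) * ENNReal.ofReal (ε ^ 2 * max (-inner ℝ (ω : V3) g) 0)) ∂sphereMeasure := by
    intro y
    -- translate by `c y`
    have htrans : volume {p : T3 | ins p y ∈ S} = volume {q : T3 | ins (c y + q) y ∈ S} := by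
      rw [show {q : T3 | ins (c y + q) y ∈ S} = (fun q => c y + q) ⁻¹' {p : T3 | ins p y ∈ S} from rfl,
        measure_preimage_add]
    rw [htrans]
    -- write as a lintegral and identify the integrand with the entrance-law integrand
    have hmeasq : MeasurableSet {q : T3 | ins (c y + q) y ∈ S} := by
      have hm : Measurable fun q : T3 => ins (c y + q) y :=
        hins_meas2.comp ((measurable_const.add measurable_id).prodMk measurable_const)
      exact hm hSm
    rw [← lintegral_indicator_one hmeasq]
    rw [← lintegral_entranceLaw_torus g hg hε hε4 hw hgw (H y) (hHmeas y)]
    refine lintegral_congr fun q => ?_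
    -- pointwise identity
    set tq : ℝ := sInf {t : ℝ | 0 < t ∧ ‖Torus.reprSym (q + Torus.proj (t • g))‖ ≤ ε} with htqdef
    by_cases hmem : tq ∈ Set.Ioc 0 w
    · -- on the image: invert the parametrisation
      have hinv : ins (c y + q) y =
          contactConfig ε (X y) v i j tq (ε⁻¹ • Torus.reprSym (q + Torus.proj (tq • g))) := by
        rw [hins_eq_update, contactConfig]
        congr 1
        rw [contactPos, smul_smul, mul_inv_cancel₀ hε.ne', one_smul, Torus.proj_sub, Torus.proj_reprSym,
          add_sub_cancel_right]
        show c y + q = X y j + q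
        rw [hXj]
      rw [Set.indicator_of_mem hmem, one_mul, hHapply, ← hinv]
      simp only [Set.indicator_apply, Set.mem_setOf_eq, hSdef, Set.mem_inter_iff, htE, ← htqdef, hmem, and_true,
        Pi.one_apply]
    · rw [Set.indicator_of_notMem hmem, zero_mul]
      simp only [Set.indicator_apply, Set.mem_setOf_eq, hSdef, Set.mem_inter_iff, htE, ← htqdef, hmem, and_false,
        if_false, Pi.one_apply]
  -- Step 3: integrate over `y` and swap
  rw [hS_eq]
  simp_rw [hfib]
  -- swap `y` and `ω`
  have hF1 : Measurable fun q : (Fin N → T3) × Metric.sphere (0 : V3) 1 =>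
      ∫⁻ t in Set.Ioc 0 w, H q.1 (t, (q.2 : V3)) * ENNReal.ofReal (ε ^ 2 * max (-inner ℝ (q.2 : V3) g) 0) := by
    refine Measurable.lintegral_prod_right' (f := fun r : ((Fin N → T3) × Metric.sphere (0 : V3) 1) × ℝ =>
      H r.1.1 (r.2, (r.1.2 : V3)) * ENNReal.ofReal (ε ^ 2 * max (-inner ℝ (r.1.2 : V3) g) 0)) ?_
    refine Measurable.mul ?_ ?_
    · exact hHjoint.comp ((measurable_fst.comp measurable_fst).prodMk
        (measurable_snd.prodMk ((continuous_subtype_val.measurable).comp (measurable_snd.comp measurable_fst))))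
    · refine ENNReal.measurable_ofReal.comp (measurable_const.mul ((Measurable.max ?_ measurable_const)))
      exact ((continuous_subtype_val.comp (continuous_snd.comp continuous_fst)).inner continuous_const).neg.measurable
  rw [lintegral_lintegral_swap (f := fun (y : Fin N → T3) (ω : Metric.sphere (0 : V3) 1) =>
    ∫⁻ t in Set.Ioc 0 w, H y (t, (ω : V3)) * ENNReal.ofReal (ε ^ 2 * max (-inner ℝ (ω : V3) g) 0))
    hF1.aemeasurable]
  refine lintegral_congr fun ω => ?_
  -- swap `y` and `t`
  have hF2 : Measurable fun q : (Fin N → T3) × ℝ =>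
      H q.1 (q.2, (ω : V3)) * ENNReal.ofReal (ε ^ 2 * max (-inner ℝ (ω : V3) g) 0) := by
    refine Measurable.mul ?_ measurable_const
    exact hHjoint.comp (measurable_fst.prodMk (measurable_snd.prodMk measurable_const))
  rw [lintegral_lintegral_swap (f := fun (y : Fin N → T3) (t : ℝ) =>
    H y (t, (ω : V3)) * ENNReal.ofReal (ε ^ 2 * max (-inner ℝ (ω : V3) g) 0)) hF2.aemeasurable]
  refine lintegral_congr fun t => ?_
  have hF3 : Measurable fun y : Fin N → T3 => H y (t, (ω : V3)) :=
    hHjoint.comp (measurable_id.prodMk measurable_const)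
  rw [lintegral_mul_const _ hF3]
  congr 1
  -- Step 4: the inner integral is the volume of the pre-image
  have hgm : Measurable ((fun p : (Fin (N + 1) → T3) × ℝ × V3 => contactConfig ε p.1 v i j p.2.1 p.2.2) ∘
      fun y : Fin N → T3 => (X y, t, (ω : V3))) :=
    (measurable_contactConfig ε v i j).comp (hXmeas.prodMk measurable_const)
  obtain ⟨P', hP'def⟩ : ∃ P' : Set (Fin N → T3),
      P' = ((fun p : (Fin (N + 1) → T3) × ℝ × V3 => contactConfig ε p.1 v i j p.2.1 p.2.2) ∘
        fun y : Fin N → T3 => (X y, t, (ω : V3))) ⁻¹' A := ⟨_, rfl⟩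
  have hP'm : MeasurableSet P' := by
    rw [hP'def]
    exact hA.preimage hgm
  have hmemP' : ∀ y, y ∈ P' ↔ contactConfig ε (X y) v i j t ω ∈ A := by
    intro y
    rw [hP'def, Set.mem_preimage, Function.comp_apply]
  have hpre : ∫⁻ y : Fin N → T3, H y (t, (ω : V3)) = volume P' := by
    rw [← lintegral_indicator_one hP'm]
    refine lintegral_congr fun y => ?_
    rw [hHapply]
    simp only [Set.indicator_apply, hmemP', Pi.one_apply]
  rw [hpre]
  -- and the pre-image in `(𝕋³)^{N+1}` is a cylinder over it
  have hcyl : (fun x => contactConfig ε x v i j t (ω : V3)) ⁻¹' A = e ⁻¹' ((Set.univ : Set T3) ×ˢ P') := by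
    ext x
    simp only [Set.mem_preimage, Set.mem_prod, Set.mem_univ, true_and, hmemP']
    have hx : x = ins (e x).1 (e x).2 := by
      rw [← hesymm]
      exact (e.symm_apply_apply x).symm
    conv_lhs => rw [hx, hcC_ins]
  rw [hcyl, he.measure_preimage (MeasurableSet.univ.prod hP'm).nullMeasurableSet, Measure.prod_prod, measure_univ,
    one_mul]

end EntranceCoordinates


end

end Summit.AtomisticToContinuum.HydrodynamicLimit.Theorems.OLC

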